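import Literature.Barriers.ABC.BakerMethodBoundsStewartYuProofs
import Literature.NumberTheory.DiophantineGeometry.StewartPadicOrderLemma8Proofs
import Literature.NumberTheory.Sieve.ParityWave0MaynardTaoProofs
import HarnessLib

/-!
# Sub-power Stewart–Yu (crux `SubPowerStewartYu`, stmt-ABC-11053), IV: real-variable estimates

`Summits/ABC/ABC/Theorems/LogCardinalitySubPowerStewartYuAnalysis.lean` — fourth helper file toward
`Summit.ABC.ABC.Theses.LogCardinality.SubPowerStewartYu`. Pure real analysis and counting, no
linear forms:

* `numeric_core`: the absorption of Stewart's inflated Yu bound — with `k = j + 1` logarithms'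
  worth of auxiliary primes of size `≤ e^m`, `n ≤ k + 1` original primes, `8Ā²km ≤ e⁻⁴ L`,
  the right side of Yu's bound at `p = e^{L}` is `≤ 3 e^{−3k} p` (times the common factors)
  [cite: Stewart2013, proof of Lemma 8, (33)–(38) (arXiv p. 10)] — Stewart's `k = [log p / 51.8 log log p]`
  computation with the constants of the crux's inlined hypothesis;
* `max_log_le`: the exponent factor `max(log(2 + 2k Σν), n'²) ≤ 4k² · log max{e, 2 log c}`;
* `exists_auxPrimes_le`: `k − 1` auxiliary primes outside a forbidden set of `t + 1` primes, all
  `≤ 45 (k+t) log(k+t)` (Chebyshev, `Literature.NumberTheory.Sieve.nth_prime_le_mul_log`);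
* `lt_of_prod_mul_gt`: bookkeeping for the slack dichotomy;
* `le_of_cube_le_saving`: cube root and self-improvement with a saving factor `E`
  (the analogue of `Literature.Barriers.ABC.le_of_cube_le`);
* small eventual inequalities (`log x ≤ √x`-type facts) used to fix the threshold `R₀`.
No new definitions.
-/

noncomputable section

-- `Summit.ABC.ABC.…` is the tree's namespace convention for this sub-problem (summit = problem).
set_option linter.dupNamespace false

open Finset Real
open Literature.NumberTheory.DiophantineGeometry
open Literature.NumberTheory.DiophantineGeometry.Dioph
open Literature.Barriers.ABC

namespace Summit.ABC.ABC.Theorems.SubPowerSY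

/-! ### Elementary real inequalities -/

/-- `log x ≤ √x` for `x ≥ 0`. [folklore] -/
theorem log_le_sqrt {x : ℝ} (hx : 0 ≤ x) : Real.log x ≤ Real.sqrt x := by
  -- `log x = 2 log √x` and `log s ≤ s/e ≤ s/2` (from `log(s/e) ≤ s/e − 1`)
  rcases hx.eq_or_lt with h0 | hxpos
  · rw [← h0]; simp
  have hs : 0 < Real.sqrt x := Real.sqrt_pos.2 hxpos
  have hlog : Real.log x = 2 * Real.log (Real.sqrt x) := by
    conv_lhs => rw [← Real.mul_self_sqrt hx]
    rw [Real.log_mul hs.ne' hs.ne']; ring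
  have he : 0 < Real.exp 1 := Real.exp_pos 1
  have h1 := Real.log_le_sub_one_of_pos (show 0 < Real.sqrt x / Real.exp 1 by positivity)
  rw [Real.log_div hs.ne' he.ne', Real.log_exp] at h1
  have he2 : 2 ≤ Real.exp 1 := by have := Real.add_one_le_exp (1 : ℝ); linarith
  have h2 : Real.sqrt x / Real.exp 1 ≤ Real.sqrt x / 2 :=
    div_le_div_of_nonneg_left hs.le two_pos he2
  rw [hlog]; linarith

/-- `x / log x ≥ √x` for `x > 1`. [folklore] -/
theorem sqrt_le_div_log {x : ℝ} (hx : 1 < x) : Real.sqrt x ≤ x / Real.log x := by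
  have hlog : 0 < Real.log x := Real.log_pos hx
  rw [le_div_iff₀ hlog]
  have hs := log_le_sqrt (zero_le_one.trans hx.le)
  have hss : Real.sqrt x * Real.sqrt x = x := Real.mul_self_sqrt (zero_le_one.trans hx.le)
  nlinarith [Real.sqrt_nonneg x]

/-- `log x + 1 ≤ x / 8` for `x ≥ 289`. [folklore] -/
theorem log_add_one_le_div_eight {x : ℝ} (hx : 289 ≤ x) : Real.log x + 1 ≤ x / 8 := by
  have hx0 : 0 ≤ x := by linarith
  have h := Real.log_le_rpow_div hx0 (show (0 : ℝ) < 1 / 2 by norm_num)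
  rw [← Real.sqrt_eq_rpow] at h
  have h17 : 17 ≤ Real.sqrt x := by
    rw [show (17 : ℝ) = Real.sqrt (17 ^ 2) by rw [Real.sqrt_sq (by norm_num)]]
    exact Real.sqrt_le_sqrt (by norm_num; linarith)
  have hss : Real.sqrt x * Real.sqrt x = x := Real.mul_self_sqrt hx0
  nlinarith

/-! ### Bookkeeping for the slack dichotomy -/

/-- If `J₁ J₂ J₃ · E > C³ r₁ r₂ r₃` while `Jᵢ ≤ C rᵢ` for `i = 2, 3` (`C, r₂, r₃ > 0`), then
`J₁ E > C r₁`. [folklore] -/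
theorem lt_of_prod_mul_gt {J₁ J₂ J₃ r₁ r₂ r₃ C E : ℝ} (hC : 0 < C) (hr₂ : 0 < r₂) (hr₃ : 0 < r₃)
    (hJ₁ : 0 ≤ J₁) (hJ₂ : 0 ≤ J₂) (hE : 0 ≤ E)
    (h₂ : J₂ ≤ C * r₂) (h₃ : J₃ ≤ C * r₃) (h : C ^ 3 * (r₁ * r₂ * r₃) < J₁ * J₂ * J₃ * E) :
    C * r₁ < J₁ * E := by
  by_contra hcon
  push Not at hcon
  have hJ₃ : 0 ≤ J₃ := by
    by_contra h3
    push Not at h3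
    have : J₁ * J₂ * J₃ * E ≤ 0 := by
      have := mul_nonneg hJ₁ hJ₂
      nlinarith [mul_nonneg (mul_nonneg this (le_of_lt (neg_pos.mpr h3))) hE]
    have : 0 ≤ C ^ 3 * (r₁ * r₂ * r₃) := by
      have hr₁ : 0 ≤ C * r₁ := le_trans (mul_nonneg hJ₁ hE) hcon
      have : 0 ≤ r₁ := by
        by_contra hr; push Not at hr; nlinarith
      positivity
    linarith
  have key : J₁ * J₂ * J₃ * E ≤ (C * r₁) * (C * r₂) * (C * r₃) := by
    calc J₁ * J₂ * J₃ * E = (J₁ * E) * J₂ * J₃ := by ring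
      _ ≤ (C * r₁) * (C * r₂) * (C * r₃) :=
          mul_le_mul (mul_le_mul hcon h₂ hJ₂ (le_trans (mul_nonneg hJ₁ hE) hcon)) h₃ hJ₃
            (mul_nonneg (le_trans (mul_nonneg hJ₁ hE) hcon) (by positivity))
  nlinarith

/-! ### The exponent factor -/

/-- **The exponent factor.** With `y = log c ≥ 0`, `Y = log max{e, 2y}`, `Σ · log 2 ≤ 2y`
(`Σ = ∑_{q ∣ uv} ν_q(uv)`, `uv ≤ c²`), `k = j + 1 ≥ 1` and `n + j ≤ 2k`:
`max(log(2 + 2k Σ), (n+j)²) ≤ 4 k² Y`. [folklore] -/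
theorem max_log_le {y S : ℝ} {n j : ℕ} (hy : 0 ≤ y) (hS0 : 0 ≤ S) (hS : S * Real.log 2 ≤ 2 * y)
    (hnj : n + j ≤ 2 * (j + 1)) :
    max (Real.log (2 + 2 * ((j : ℝ) + 1) * S)) (((n + j : ℕ) : ℝ) ^ 2) ≤
      4 * ((j : ℝ) + 1) ^ 2 * Real.log (max (Real.exp 1) (2 * y)) := by
  set Z := max (Real.exp 1) (2 * y) with hZ
  set Y := Real.log Z with hY
  have he : 2 < Real.exp 1 := by have := Real.exp_one_gt_d9; linarith
  have hZe : Real.exp 1 ≤ Z := le_max_left _ _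
  have hZ2 : 2 ≤ Z := by linarith
  have hZy : 2 * y ≤ Z := le_max_right _ _
  have hZpos : 0 < Z := by linarith
  have hY1 : 1 ≤ Y := by
    rw [hY, ← Real.log_exp 1]; exact Real.log_le_log (Real.exp_pos 1) hZe
  have hk1 : (1 : ℝ) ≤ (j : ℝ) + 1 := by
    have : (0 : ℝ) ≤ j := Nat.cast_nonneg j
    linarith
  have hlog2 : (0.6931471803 : ℝ) < Real.log 2 := Real.log_two_gt_d9
  -- `S ≤ 3y ≤ 1.5 Z`
  have hS3 : S ≤ 3 * y := by nlinarith
  have harg : 2 + 2 * ((j : ℝ) + 1) * S ≤ 4 * ((j : ℝ) + 1) * Z := by nlinarith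
  have harg0 : 0 < 2 + 2 * ((j : ℝ) + 1) * S := by positivity
  refine max_le ?_ ?_
  · have h1 : Real.log (2 + 2 * ((j : ℝ) + 1) * S) ≤ Real.log (4 * ((j : ℝ) + 1)) + Y := by
      calc Real.log (2 + 2 * ((j : ℝ) + 1) * S) ≤ Real.log (4 * ((j : ℝ) + 1) * Z) :=
            Real.log_le_log harg0 harg
        _ = Real.log (4 * ((j : ℝ) + 1)) + Y := by
            rw [hY, ← Real.log_mul (by positivity) hZpos.ne']
    -- `log(4k) + 1 ≤ 3k ≤ ...` and `log(4k) + Y ≤ (log 4k + 1) Y ≤ 3k Y ≤ 4k² Y`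
    have h2 : Real.log (4 * ((j : ℝ) + 1)) ≤ 4 * ((j : ℝ) + 1) - 1 :=
      Real.log_le_sub_one_of_pos (by positivity)
    have h3 : Real.log (4 * ((j : ℝ) + 1)) + Y ≤ (Real.log (4 * ((j : ℝ) + 1)) + 1) * Y := by
      have h4 : 0 ≤ Real.log (4 * ((j : ℝ) + 1)) := Real.log_nonneg (by linarith)
      nlinarith
    have h5 : (Real.log (4 * ((j : ℝ) + 1)) + 1) * Y ≤ 4 * ((j : ℝ) + 1) ^ 2 * Y := by
      apply mul_le_mul_of_nonneg_right _ (by linarith)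
      nlinarith
    linarith
  · have h1 : (((n + j : ℕ) : ℝ)) ≤ 2 * ((j : ℝ) + 1) := by exact_mod_cast hnj
    have h0 : (0 : ℝ) ≤ ((n + j : ℕ) : ℝ) := Nat.cast_nonneg _
    calc (((n + j : ℕ) : ℝ)) ^ 2 ≤ (2 * ((j : ℝ) + 1)) ^ 2 := pow_le_pow_left₀ h0 h1 2
      _ = 4 * ((j : ℝ) + 1) ^ 2 * 1 := by ring
      _ ≤ 4 * ((j : ℝ) + 1) ^ 2 * Y := mul_le_mul_of_nonneg_left hY1 (by positivity)

/-! ### The numeric core of the inflation -/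

/-- **Numeric core of Stewart's inflation** (the chain (33)–(38) of [Stewart2013] with the
constants of the inlined Yu bound). Parameters: `Ā ≥ 1`, auxiliary primes `k − 1 = j ≥ 1` of
logarithmic size `≤ m` (`m ≥ 1`), `n` original primes with `1 ≤ n ≤ k + 1`, `L = log p` with
`2k ≤ L`, and the three absorptions `8Ā² k m ≤ e⁻⁴ L`, `4k³ L² (4Ā²e² m)^k ≤ e^{L − 4k}`,
`8 k³ L ≤ e^k`. Then
`L · Ā^{n+j} (e^L ((n+j)/L)^{n+j} + e^{n+j} L) · (2ⁿ (3 + 2jm) m^j) · (4k²) ≤ 3 e^{−3k} e^L`.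
[cite: Stewart2013, proof of Lemma 8, (33)–(38) (arXiv p. 10)] -/
theorem numeric_core {A m L : ℝ} {j n : ℕ} (hA : 1 ≤ A) (hm : 1 ≤ m) (hj : 1 ≤ j) (hn : 1 ≤ n)
    (hnk : n ≤ j + 2) (hkL : 2 * ((j : ℝ) + 1) ≤ L)
    (hi : 8 * A ^ 2 * ((j : ℝ) + 1) * m ≤ Real.exp (-4) * L)
    (hii : 4 * ((j : ℝ) + 1) ^ 3 * L ^ 2 * (4 * A ^ 2 * Real.exp 2 * m) ^ (j + 1) ≤
      Real.exp (L - 4 * ((j : ℝ) + 1)))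
    (hiii : 8 * ((j : ℝ) + 1) ^ 3 * L ≤ Real.exp ((j : ℝ) + 1)) :
    L * (A ^ (n + j) * (Real.exp L * (((n + j : ℕ) : ℝ) / L) ^ (n + j) +
        Real.exp ((n + j : ℕ) : ℝ) * L) *
      (2 ^ n * (3 + 2 * (j : ℝ) * m) * m ^ j) * (4 * ((j : ℝ) + 1) ^ 2)) ≤
      3 * Real.exp (-3 * ((j : ℝ) + 1)) * Real.exp L := by
  -- notation
  set k : ℝ := (j : ℝ) + 1 with hk
  have hj1 : (1 : ℝ) ≤ j := by exact_mod_cast hj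
  have hk2 : 2 ≤ k := by rw [hk]; linarith
  have hkpos : 0 < k := by linarith
  have hL : 4 ≤ L := by linarith
  have hLpos : 0 < L := by linarith
  have hA0 : 0 ≤ A := by linarith
  have hm0 : 0 ≤ m := by linarith
  have hn1 : (1 : ℝ) ≤ n := by exact_mod_cast hn
  set n' : ℕ := n + j with hn'
  have hn'k : (j + 1 : ℕ) ≤ n' := by rw [hn']; omega
  have hn'2k : n' ≤ 2 * (j + 1) := by rw [hn']; omega
  have hn'r : ((n' : ℕ) : ℝ) ≤ 2 * k := by rw [hk]; exact_mod_cast hn'2k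
  have hn'r0 : (0 : ℝ) ≤ n' := Nat.cast_nonneg _
  have heL : Real.exp L > 0 := Real.exp_pos L
  -- (1) `(3 + 2jm) m^j ≤ 3k m^k` where `m^k = m^j · m`
  have h1 : (3 + 2 * (j : ℝ) * m) * m ^ j ≤ 3 * k * (m ^ j * m) := by
    have : 3 + 2 * (j : ℝ) * m ≤ 3 * k * m := by rw [hk]; nlinarith
    nlinarith [pow_nonneg hm0 j]
  -- (2) `2^n A^{n'} ≤ (4A²)^k`, i.e. `≤ (2A)^{2(j+1)}`
  have h2 : (2 : ℝ) ^ n * A ^ n' ≤ (4 * A ^ 2) ^ (j + 1) := by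
    have h2a : (2 : ℝ) ^ n ≤ 2 ^ (2 * (j + 1)) := pow_le_pow_right₀ (by norm_num) (by omega)
    have h2b : A ^ n' ≤ A ^ (2 * (j + 1)) := pow_le_pow_right₀ hA hn'2k
    calc (2 : ℝ) ^ n * A ^ n' ≤ 2 ^ (2 * (j + 1)) * A ^ (2 * (j + 1)) :=
          mul_le_mul h2a h2b (by positivity) (by positivity)
      _ = (4 * A ^ 2) ^ (j + 1) := by rw [mul_pow, pow_mul, pow_mul]; norm_num
  -- (3) `T1 ≤ e^L (2k/L)^k`
  have hratio : ((n' : ℕ) : ℝ) / L ≤ 2 * k / L := div_le_div_of_nonneg_right hn'r hLpos.le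
  have hratio1 : 2 * k / L ≤ 1 := by rw [div_le_one hLpos]; exact hkL
  have hratio0 : 0 ≤ ((n' : ℕ) : ℝ) / L := div_nonneg hn'r0 hLpos.le
  have h3 : (((n' : ℕ) : ℝ) / L) ^ n' ≤ (2 * k / L) ^ (j + 1) := by
    calc (((n' : ℕ) : ℝ) / L) ^ n' ≤ (2 * k / L) ^ n' := pow_le_pow_left₀ hratio0 hratio n'
      _ ≤ (2 * k / L) ^ (j + 1) :=
          pow_le_pow_of_le_one (le_trans hratio0 hratio) hratio1 hn'k
  -- (4) `T2 ≤ e^{2k} L`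
  have h4 : Real.exp ((n' : ℕ) : ℝ) ≤ Real.exp (2 * k) := Real.exp_le_exp.mpr hn'r
  -- (5) the two absorbed terms
  have hbase : (4 * A ^ 2) * m * (2 * k / L) ≤ Real.exp (-4) := by
    have : (4 * A ^ 2) * m * (2 * k / L) = (8 * A ^ 2 * k * m) / L := by ring
    rw [this, div_le_iff₀ hLpos]
    exact hi
  have hbase0 : 0 ≤ (4 * A ^ 2) * m * (2 * k / L) := by positivity
  have h5 : ((4 * A ^ 2) * m * (2 * k / L)) ^ (j + 1) ≤ Real.exp (-4 * k) := by
    calc ((4 * A ^ 2) * m * (2 * k / L)) ^ (j + 1) ≤ Real.exp (-4) ^ (j + 1) :=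
          pow_le_pow_left₀ hbase0 hbase _
      _ = Real.exp (-4 * k) := by rw [← Real.exp_nat_mul, hk]; push_cast; ring_nf
  have h6 : ((4 * A ^ 2) * m) ^ (j + 1) * Real.exp (2 * k) = (4 * A ^ 2 * Real.exp 2 * m) ^ (j + 1) := by
    rw [show Real.exp (2 * k) = Real.exp 2 ^ (j + 1) by rw [← Real.exp_nat_mul, hk]; push_cast; ring_nf]
    rw [← mul_pow]; ring
  -- assemble the main product
  have hT1 : 0 ≤ Real.exp L * (((n' : ℕ) : ℝ) / L) ^ n' := by positivity
  have hT2 : 0 ≤ Real.exp ((n' : ℕ) : ℝ) * L := by positivity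
  have hX : A ^ n' * (Real.exp L * (((n' : ℕ) : ℝ) / L) ^ n' + Real.exp ((n' : ℕ) : ℝ) * L) *
      (2 ^ n * (3 + 2 * (j : ℝ) * m) * m ^ j) ≤
      3 * k * ((4 * A ^ 2) * m) ^ (j + 1) *
        (Real.exp L * (2 * k / L) ^ (j + 1) + Real.exp (2 * k) * L) := by
    have hsum : Real.exp L * (((n' : ℕ) : ℝ) / L) ^ n' + Real.exp ((n' : ℕ) : ℝ) * L ≤
        Real.exp L * (2 * k / L) ^ (j + 1) + Real.exp (2 * k) * L :=
      add_le_add (mul_le_mul_of_nonneg_left h3 heL.le) (mul_le_mul_of_nonneg_right h4 hLpos.le)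
    have hsum0 : 0 ≤ Real.exp L * (((n' : ℕ) : ℝ) / L) ^ n' + Real.exp ((n' : ℕ) : ℝ) * L :=
      add_nonneg hT1 hT2
    calc A ^ n' * (Real.exp L * (((n' : ℕ) : ℝ) / L) ^ n' + Real.exp ((n' : ℕ) : ℝ) * L) *
          (2 ^ n * (3 + 2 * (j : ℝ) * m) * m ^ j)
        = (2 ^ n * A ^ n') * ((3 + 2 * (j : ℝ) * m) * m ^ j) *
            (Real.exp L * (((n' : ℕ) : ℝ) / L) ^ n' + Real.exp ((n' : ℕ) : ℝ) * L) := by ring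
      _ ≤ (4 * A ^ 2) ^ (j + 1) * (3 * k * (m ^ j * m)) *
            (Real.exp L * (2 * k / L) ^ (j + 1) + Real.exp (2 * k) * L) := by
          apply mul_le_mul (mul_le_mul h2 h1 (by positivity) (by positivity)) hsum hsum0
          positivity
      _ = 3 * k * ((4 * A ^ 2) * m) ^ (j + 1) *
            (Real.exp L * (2 * k / L) ^ (j + 1) + Real.exp (2 * k) * L) := by
          rw [mul_pow, ← pow_succ]; ring
  -- expand and absorb
  have hY : 3 * k * ((4 * A ^ 2) * m) ^ (j + 1) *
      (Real.exp L * (2 * k / L) ^ (j + 1) + Real.exp (2 * k) * L) =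
      3 * k * (((4 * A ^ 2) * m * (2 * k / L)) ^ (j + 1) * Real.exp L) +
        3 * k * L * (4 * A ^ 2 * Real.exp 2 * m) ^ (j + 1) := by
    rw [mul_pow ((4 * A ^ 2) * m) (2 * k / L) (j + 1), ← h6]; ring
  have hZ1 : 3 * k * (((4 * A ^ 2) * m * (2 * k / L)) ^ (j + 1) * Real.exp L) ≤
      3 * k * (Real.exp (-4 * k) * Real.exp L) := by
    apply mul_le_mul_of_nonneg_left _ (by positivity)
    exact mul_le_mul_of_nonneg_right h5 heL.le
  have hsplitexp : Real.exp (L - 4 * k) = Real.exp (-4 * k) * Real.exp L := by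
    rw [← Real.exp_add]; ring_nf
  have hii' : L * (3 * k * L * (4 * A ^ 2 * Real.exp 2 * m) ^ (j + 1)) * (4 * k ^ 2) ≤
      3 * (Real.exp (-4 * k) * Real.exp L) := by
    have hrw : L * (3 * k * L * (4 * A ^ 2 * Real.exp 2 * m) ^ (j + 1)) * (4 * k ^ 2) =
        3 * (4 * k ^ 3 * L ^ 2 * (4 * A ^ 2 * Real.exp 2 * m) ^ (j + 1)) := by ring
    rw [hrw, ← hsplitexp]
    exact mul_le_mul_of_nonneg_left hii (by norm_num)
  -- `e^{-4k} (12 k³ L + 3) ≤ 3 e^{-3k}` from `8k³L ≤ e^k`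
  have hexp : Real.exp (-4 * k) = Real.exp (-3 * k) * Real.exp (-k) := by
    rw [← Real.exp_add]; ring_nf
  have hek : Real.exp (-k) * Real.exp k = 1 := by rw [← Real.exp_add]; simp
  have hek0 : 0 < Real.exp (-k) := Real.exp_pos _
  have h8 : 8 * k ^ 3 * L * Real.exp (-k) ≤ 1 := by
    have := mul_le_mul_of_nonneg_right hiii hek0.le
    rwa [mul_comm (Real.exp k), hek] at this
  have hkL1 : 32 ≤ k ^ 3 * L := by
    have hk3 : (8 : ℝ) ≤ k ^ 3 := by
      have := pow_le_pow_left₀ (by norm_num : (0:ℝ) ≤ 2) hk2 3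
      norm_num at this; exact this
    calc (32 : ℝ) = 8 * 4 := by norm_num
      _ ≤ k ^ 3 * L := mul_le_mul hk3 hL (by norm_num) (by positivity)
  have hlastA : 12 * k ^ 3 * L * Real.exp (-k) ≤ 3 / 2 := by linarith
  have hlastB : Real.exp (-k) ≤ 1 / 256 := by
    have h256 : Real.exp (-k) * 256 ≤ Real.exp (-k) * (8 * (k ^ 3 * L)) :=
      mul_le_mul_of_nonneg_left (by linarith) hek0.le
    have : Real.exp (-k) * (8 * (k ^ 3 * L)) = 8 * k ^ 3 * L * Real.exp (-k) := by ring
    linarith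
  have hlast : (12 * k ^ 3 * L + 3) * Real.exp (-k) ≤ 3 := by
    have : (12 * k ^ 3 * L + 3) * Real.exp (-k) = 12 * k ^ 3 * L * Real.exp (-k) + 3 * Real.exp (-k) := by
      ring
    linarith
  have hE3 : 0 ≤ Real.exp (-3 * k) * Real.exp L := by positivity
  calc L * (A ^ n' * (Real.exp L * (((n' : ℕ) : ℝ) / L) ^ n' + Real.exp ((n' : ℕ) : ℝ) * L) *
        (2 ^ n * (3 + 2 * (j : ℝ) * m) * m ^ j) * (4 * k ^ 2))
      ≤ L * (3 * k * ((4 * A ^ 2) * m) ^ (j + 1) *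
          (Real.exp L * (2 * k / L) ^ (j + 1) + Real.exp (2 * k) * L) * (4 * k ^ 2)) := by
        apply mul_le_mul_of_nonneg_left _ hLpos.le
        exact mul_le_mul_of_nonneg_right hX (by positivity)
    _ = L * (3 * k * (((4 * A ^ 2) * m * (2 * k / L)) ^ (j + 1) * Real.exp L)) * (4 * k ^ 2) +
          L * (3 * k * L * (4 * A ^ 2 * Real.exp 2 * m) ^ (j + 1)) * (4 * k ^ 2) := by
        rw [hY]; ring
    _ ≤ L * (3 * k * (Real.exp (-4 * k) * Real.exp L)) * (4 * k ^ 2) +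
          3 * (Real.exp (-4 * k) * Real.exp L) := by
        apply add_le_add _ hii'
        apply mul_le_mul_of_nonneg_right _ (by positivity)
        exact mul_le_mul_of_nonneg_left hZ1 hLpos.le
    _ = (12 * k ^ 3 * L + 3) * Real.exp (-k) * (Real.exp (-3 * k) * Real.exp L) := by
        rw [hexp]; ring
    _ ≤ 3 * (Real.exp (-3 * k) * Real.exp L) :=
        mul_le_mul_of_nonneg_right hlast hE3
    _ = 3 * Real.exp (-3 * k) * Real.exp L := by ring

/-! ### Auxiliary primes -/

/-- **Auxiliary primes with a size bound** ([Stewart2013], (34), via Chebyshev): given a finite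
set `Bad` of at most `t + 1` forbidden numbers and `k ≥ 2`, there are `k − 1` primes outside `Bad`,
each at most `45 (k + t) log(k + t)`. [cite: Stewart2013, proof of Lemma 8, (34) (arXiv p. 10)] -/
theorem exists_auxPrimes_le (k t : ℕ) (hk : 2 ≤ k) (Bad : Finset ℕ) (hBad : Bad.card ≤ t + 1) :
    ∃ P : Finset ℕ, P.card = k - 1 ∧
      ∀ q ∈ P, q.Prime ∧ q ∉ Bad ∧ (q : ℝ) ≤ 45 * ((k + t : ℕ) : ℝ) * Real.log ((k + t : ℕ) : ℝ) := by
  obtain ⟨P, hPcard, hP⟩ := exists_auxPrimes k t Bad hBad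
  refine ⟨P, hPcard, fun q hq => ⟨(hP q hq).1, (hP q hq).2.1, ?_⟩⟩
  have h1 : (q : ℝ) ≤ Nat.nth Nat.Prime (k + t) := by exact_mod_cast (hP q hq).2.2
  exact h1.trans (Literature.NumberTheory.Sieve.nth_prime_le_mul_log (by omega))

/-! ### Cube root and self-improvement with a saving -/

/-- **From the cube to the bound, with a saving factor.** If `R ≥ 2`, `K, C ≥ 1`,
`1 ≤ E ≤ R^{1/3}` and `y³ ≤ 64 K⁹ C³ Λ⁶ Y³ R / E³` with `Λ = max(1, log R)`,
`Y = log max{e, 2y}`, then `y ≤ 64 K³ C (log(16K³C) + 3) · R^{1/3} (log R)³ / E`.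
(The proof of `Literature.Barriers.ABC.le_of_cube_le` with `M = 4K³CΛ²R^{1/3}/E`.) [folklore] -/
theorem le_of_cube_le_saving {K C R E y : ℝ} (hK : 1 ≤ K) (hC : 1 ≤ C) (hR : 2 ≤ R)
    (hE1 : 1 ≤ E) (hER : E ≤ R ^ (1 / 3 : ℝ))
    (h : y ^ 3 ≤ 64 * K ^ 9 * C ^ 3 * max 1 (Real.log R) ^ 6 *
      Real.log (max (Real.exp 1) (2 * y)) ^ 3 * R / E ^ 3) :
    y ≤ 64 * K ^ 3 * C * (Real.log (16 * K ^ 3 * C) + 3) * R ^ (1 / 3 : ℝ) * Real.log R ^ 3 / E := by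
  set L : ℝ := Real.log R with hL
  set Λ : ℝ := max 1 L with hΛ
  set Y : ℝ := Real.log (max (Real.exp 1) (2 * y)) with hYdef
  set c₀ : ℝ := Real.log (16 * K ^ 3 * C) with hc₀
  set M : ℝ := 4 * K ^ 3 * C * Λ ^ 2 * (R ^ (1 / 3 : ℝ) / E) with hM
  have hR0 : 0 < R := by linarith
  have hK0 : 0 < K := by linarith
  have hC0 : 0 < C := by linarith
  have hE0 : 0 < E := by linarith
  have hY1 : 1 ≤ Y := Literature.NumberTheory.DiophantineGeometry.Pasten.one_le_log_max_exp _
  have hΛ1 : 1 ≤ Λ := le_max_left _ _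
  have hR13 : (R ^ (1 / 3 : ℝ)) ^ 3 = R := by
    rw [← Real.rpow_mul_natCast hR0.le]; norm_num
  have hRE1 : 1 ≤ R ^ (1 / 3 : ℝ) / E := by rw [le_div_iff₀ hE0, one_mul]; exact hER
  have hK3 : 1 ≤ K ^ 3 := one_le_pow₀ hK
  have hM1 : 1 ≤ M := by
    have h1 : (1 : ℝ) ≤ 4 * K ^ 3 * C := by nlinarith
    have h2 : (1 : ℝ) ≤ Λ ^ 2 := one_le_pow₀ hΛ1
    calc (1 : ℝ) = 1 * 1 * 1 := by ring
      _ ≤ 4 * K ^ 3 * C * Λ ^ 2 * (R ^ (1 / 3 : ℝ) / E) :=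
          mul_le_mul (mul_le_mul h1 h2 zero_le_one (by positivity)) hRE1 zero_le_one
            (by positivity)
  have hMY : (M * Y) ^ 3 = 64 * K ^ 9 * C ^ 3 * Λ ^ 6 * Y ^ 3 * R / E ^ 3 := by
    calc (M * Y) ^ 3 = 64 * K ^ 9 * C ^ 3 * Λ ^ 6 * Y ^ 3 * (R ^ (1 / 3 : ℝ)) ^ 3 / E ^ 3 := by
          rw [hM]; field_simp; ring
      _ = _ := by rw [hR13]
  have h1 : y ≤ M * Y := by
    refine le_of_pow_le_pow_left₀ (by norm_num : (3 : ℕ) ≠ 0) (by positivity) ?_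
    rw [hMY]; exact h
  have h2 : y ≤ 2 * M * Real.log (4 * M) := le_of_le_mul_log_max hM1 h1
  -- `log(4M) ≤ (c₀ + 3) Λ`
  have hc₀0 : 0 ≤ c₀ := Real.log_nonneg (by nlinarith)
  have hlog4M : Real.log (4 * M) ≤ (c₀ + 3) * Λ := by
    have h4M : 4 * M = (16 * K ^ 3 * C) * (Λ ^ 2 * (R ^ (1 / 3 : ℝ) / E)) := by rw [hM]; ring
    have hΛ0 : 0 < Λ := by linarith
    have hx : (16 * K ^ 3 * C) ≠ 0 := by positivity
    have hy' : Λ ^ 2 * (R ^ (1 / 3 : ℝ) / E) ≠ 0 := by positivity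
    have hexp : Real.log (4 * M) = c₀ + 2 * Real.log Λ + (1 / 3 * L - Real.log E) := by
      rw [h4M, Real.log_mul hx hy', Real.log_mul (x := Λ ^ 2) (y := R ^ (1 / 3 : ℝ) / E)
        (by positivity) (by positivity), Real.log_pow, Real.log_div (by positivity) hE0.ne',
        Real.log_rpow hR0, hc₀, hL]
      push_cast
      ring
    have hlogΛ : Real.log Λ ≤ Λ := Real.log_le_self hΛ0.le
    have hLΛ : L ≤ Λ := le_max_right _ _
    have hc₀Λ : c₀ ≤ c₀ * Λ := le_mul_of_one_le_right hc₀0 hΛ1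
    have hlogE : 0 ≤ Real.log E := Real.log_nonneg hE1
    rw [hexp]
    nlinarith
  -- `Λ ≤ 2 L`
  have hL2 : Real.log 2 ≤ L := Real.log_le_log two_pos hR
  have hlog2 : (1 / 2 : ℝ) ≤ Real.log 2 := by have := Real.log_two_gt_d9; linarith
  have hL0 : 0 ≤ L := by linarith
  have hΛL : Λ ≤ 2 * L := max_le (by linarith) (by linarith)
  have hM0 : 0 ≤ M := by linarith
  calc y ≤ 2 * M * Real.log (4 * M) := h2
    _ ≤ 2 * M * ((c₀ + 3) * Λ) := mul_le_mul_of_nonneg_left hlog4M (by positivity)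
    _ = 8 * K ^ 3 * C * (c₀ + 3) * (R ^ (1 / 3 : ℝ) / E) * Λ ^ 3 := by rw [hM]; ring
    _ ≤ 8 * K ^ 3 * C * (c₀ + 3) * (R ^ (1 / 3 : ℝ) / E) * (2 * L) ^ 3 := by
        apply mul_le_mul_of_nonneg_left (pow_le_pow_left₀ (by linarith) hΛL 3) (by positivity)
    _ = 64 * K ^ 3 * C * (c₀ + 3) * R ^ (1 / 3 : ℝ) * L ^ 3 / E := by ring

end Summit.ABC.ABC.Theorems.SubPowerSY

end
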